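import Literature.Computability.Cryptography.PeriodisedFourierTransform
import HarnessLib

/-!
# The QFT over `ℤ_p` through `ℤ_Q`, II: the windows of the "division by `Q/p`" step

Topic `Literature/Computability/Cryptography`, sequel of `PeriodisedFourierTransform.lean`
(Hales 2002, Ch. 5 §1 Algorithm 3: after the transform over `ℤ_Q` of the `R`-fold repetition,
"division by `M/N`: `|j⟩ ↦ |i⟩|t⟩` where `j = ⌊Mi/N⌉ + t` and `−M/2N ≤ t < M/2N`"). The machine
realises this division by ROUNDING: from the transform index `y < Q` it computes the centre index
`kOf p Q y = ⌊yp/Q⌉ mod p` and then the offset `rOff p Q (kOf p Q y) y`. This file PROVES the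
bookkeeping that identifies the target vector of `PeriodisedFourierTransform.lean`,
`target x y = Σ_{i<p} (F_p)_{ix} bump_i(y)`, with a PRODUCT state under that relabelling:

* `near_spec` — `2p ⌊Qi/p⌉ + ((2Qi + p) mod 2p) = 2Qi + p`;
* **`kOf_eq_of_not_mem_tail`** — if `y` lies in the window of `i` (its offset from `⌊Qi/p⌉` is not
  in `tail`), then `⌊yp/Q⌉ ≡ i (mod p)`, i.e. `kOf p Q y = i`: the windows of distinct centres are
  disjoint (`eq_of_not_mem_tail`), so at most one term of `target x y` is non-zero;
* **`target_eq`** — the function form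
  `target x y = [rOff (kOf y) y ∉ tail] · (F_p)_{kOf y, x} · peak 0 (rOff (kOf y) y)`: reading
  `y ↦ (kOf y, rOff (kOf y) y)` (an injection, `rOff_kOf_injective`) the target IS
  `(F_p |x⟩)_k ⊗ |b_0⟩_r` with the fixed windowed bump `b_0 = peak 0 · [· ∉ tail]`.

Everything here is proved; no named fact is introduced.

## References

* L. Hales, *The Quantum Fourier Transform and Extensions of the Abelian Hidden Subgroup Problem*,
  PhD thesis, UC Berkeley 2002, arXiv:quant-ph/0212002, Ch. 5 §1 Algorithm 3 (the division step) and
  Ch. 9 §2 Thm. 10 [Hales2002].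
* L. Hales, S. Hallgren, FOCS 2000, 515–525 [HalesHallgren2000].
-/

noncomputable section

open Finset

namespace Literature.Computability.Cryptography

namespace Hales2002

/-! ### The centre index of a transform index -/

/-- **The centre index** of the transform index `y`: `kOf p Q y = ⌊yp/Q⌉ mod p` (ties up), as
`((2yp + Q) div 2Q) mod p`. [cite: Hales2002, Ch. 5 §1 Algorithm 3 (division by M/N)] -/
def kOf (p Q y : ℕ) : ℕ := (2 * y * p + Q) / (2 * Q) % p

/-- `kOf < p`. [folklore] -/
theorem kOf_lt {p : ℕ} (hp : 0 < p) (Q y : ℕ) : kOf p Q y < p := Nat.mod_lt _ hp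

/-- The defining relation of `⌊Qi/p⌉`: `2p ⌊Qi/p⌉ + ((2Qi + p) mod 2p) = 2Qi + p`. [folklore] -/
theorem near_spec (p Q i : ℕ) : 2 * p * near p Q i + (2 * Q * i + p) % (2 * p) = 2 * Q * i + p := by
  unfold near; exact Nat.div_add_mod _ _

/-- **Windows determine the centre**: if the offset of `y < Q` from `⌊Qi/p⌉` is not in the tail
(`2p(|offset|_Q + 1) ≤ Q`), then `⌊yp/Q⌉ ≡ i (mod p)`. [cite: Hales2002, Ch. 9 §2 (the bumps |b_i⟩ have disjoint supports)] -/
theorem kOf_eq_of_not_mem_tail {p Q i y : ℕ} (hp : 0 < p) (hpQ : p ≤ Q) (hi : i < p)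
    (h : rOff p Q i y ∉ tail p Q) : kOf p Q y = i := by
  have hQ : 0 < Q := lt_of_lt_of_le hp hpQ
  have hn : near p Q i ≤ Q := near_le hi hpQ
  -- the offset `r`, the quotient `q`, the remainder `m₀` of the centre
  set n := near p Q i with hn'
  set r := rOff p Q i y with hr'
  have hr : r = (y + Q - n) % Q := rfl
  have hrQ : r < Q := rOff_lt hQ i y
  have hdm : Q * ((y + Q - n) / Q) + r = y + Q - n := by rw [hr]; exact Nat.div_add_mod _ _
  set q := (y + Q - n) / Q with hq
  have hsp := near_spec p Q i
  rw [← hn'] at hsp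
  set m₀ := (2 * Q * i + p) % (2 * p) with hm₀
  have hm₀lt : m₀ < 2 * p := Nat.mod_lt _ (by omega)
  -- not in the tail: `2p (cdist + 1) ≤ Q`
  have hw : 2 * p * (cdist Q r + 1) ≤ Q := by
    have : ¬ (Q < 2 * p * (cdist Q r + 1)) := fun hlt => h (by
      rw [tail, Finset.mem_filter]; exact ⟨mem_range.2 hrQ, hlt⟩)
    omega
  -- integer form of everything
  have hyz : (y : ℤ) = n + r + Q * q - Q := by
    have h1 : ((Q * q + r : ℕ) : ℤ) = ((y + Q - n : ℕ) : ℤ) := by exact_mod_cast hdm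
    push_cast [Nat.cast_sub (show n ≤ y + Q by omega)] at h1
    linarith
  have hnz : 2 * (p : ℤ) * n = 2 * Q * i + p - m₀ := by
    have h1 : ((2 * p * n + m₀ : ℕ) : ℤ) = ((2 * Q * i + p : ℕ) : ℤ) := by exact_mod_cast hsp
    push_cast at h1
    linarith
  -- the quotient `K` and remainder `T` of `2yp + Q` by `2Q`
  obtain ⟨K, T, hKT, hT0, hT2, hKi⟩ : ∃ K T : ℤ, 2 * (y : ℤ) * p + Q = 2 * Q * K + T ∧ 0 ≤ T ∧ T < 2 * Q ∧
      ∃ c : ℤ, K = i + p * c := by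
    unfold cdist at hw
    rcases le_total r (Q - r) with hle | hle
    · -- offset to the right: `cdist = r`
      rw [min_eq_left hle] at hw
      have hw' : 2 * (p : ℤ) * (r + 1) ≤ Q := by exact_mod_cast hw
      refine ⟨i + p * (q - 1), Q + p - m₀ + 2 * p * r, ?_, ?_, ?_, q - 1, rfl⟩
      · rw [hyz]; linear_combination hnz
      · have : (m₀ : ℤ) < 2 * p := by exact_mod_cast hm₀lt
        have : (0 : ℤ) ≤ r := by exact_mod_cast Nat.zero_le r
        nlinarith
      · nlinarith
    · -- offset to the left: `cdist = Q − r`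
      rw [min_eq_right hle] at hw
      have hw' : 2 * (p : ℤ) * ((Q : ℤ) - r + 1) ≤ Q := by
        have : ((2 * p * (Q - r + 1) : ℕ) : ℤ) ≤ Q := by exact_mod_cast hw
        push_cast [Nat.cast_sub hrQ.le] at this
        linarith
      refine ⟨i + p * q, Q + p - m₀ - 2 * p * ((Q : ℤ) - r), ?_, ?_, ?_, q, rfl⟩
      · rw [hyz]; linear_combination hnz
      · have : (m₀ : ℤ) < 2 * p := by exact_mod_cast hm₀lt
        nlinarith
      · have : (r : ℤ) < Q := by exact_mod_cast hrQ
        have : (0 : ℤ) ≤ m₀ := by exact_mod_cast Nat.zero_le m₀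
        have : (0 : ℤ) < p := by exact_mod_cast hp
        nlinarith
  -- hence `(2yp + Q) div 2Q = K`
  have hQz : (0 : ℤ) < 2 * Q := by exact_mod_cast (by omega : 0 < 2 * Q)
  have hdiv : ((2 * y * p + Q) / (2 * Q) : ℕ) = (K : ℤ) := by
    rw [Int.natCast_div]
    push_cast
    rw [hKT, show 2 * (Q : ℤ) * K + T = T + 2 * Q * K by ring, Int.add_mul_ediv_left _ _ hQz.ne',
      Int.ediv_eq_zero_of_lt hT0 hT2, zero_add]
  -- `K ≥ 0` is automatic; reduce modulo `p`
  obtain ⟨c, rfl⟩ := hKi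
  have hmod : ((kOf p Q y : ℕ) : ℤ) = i := by
    unfold kOf
    rw [Int.natCast_mod, hdiv]
    rw [Int.add_mul_emod_self_left, Int.emod_eq_of_lt (by exact_mod_cast Nat.zero_le i) (by exact_mod_cast hi)]
  exact_mod_cast hmod

/-- **The windows of distinct centres are disjoint**: if the offsets of `y` from `⌊Qi/p⌉` and from
`⌊Qi'/p⌉` are both outside the tail then `i = i'`. [cite: Hales2002, Ch. 9 §2 ("the |b_i⟩ have disjoint supports")] -/
theorem eq_of_not_mem_tail {p Q i i' y : ℕ} (hp : 0 < p) (hpQ : p ≤ Q) (hi : i < p) (hi' : i' < p)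
    (h : rOff p Q i y ∉ tail p Q) (h' : rOff p Q i' y ∉ tail p Q) : i = i' := by
  rw [← kOf_eq_of_not_mem_tail hp hpQ hi h, ← kOf_eq_of_not_mem_tail hp hpQ hi' h']

/-! ### The target vector in function form -/

/-- **The target as a product state.** For `y < Q`:
`target x y = [rOff (kOf y) y ∉ tail] · (F_p)_{kOf y, x} · peak 0 (rOff (kOf y) y)` — under the
relabelling `y ↦ (kOf y, rOff (kOf y) y)` of the division step, the centre register carries
`F_p|x⟩` and the offset register the fixed windowed bump `b_0 = peak 0 · [· ∉ tail]`.
[cite: Hales2002, Ch. 9 §2 Thm. 10 (Σ_i (F_N v)_i |u⟩^{i'}; "by measuring the offset from the nearest i' the superposition collapses exactly to F_N|v⟩")] -/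
theorem target_eq {p R Q x y : ℕ} (hp : 0 < p) (hpQ : p ≤ Q) :
    target p R Q x y =
      if rOff p Q (kOf p Q y) y ∈ tail p Q then 0
      else fpEntry p (kOf p Q y) x * peak p R Q 0 (rOff p Q (kOf p Q y) y) := by
  have hk : kOf p Q y < p := kOf_lt hp Q y
  rw [target, Finset.sum_eq_single (kOf p Q y)]
  · simp only [bump]
    split_ifs with h
    · rw [mul_zero]
    · rw [speak_eq_peak_zero_rOff hp hk hpQ]
  · intro i hi hne
    simp only [bump]
    split_ifs with h
    · rw [mul_zero]
    · exact absurd (kOf_eq_of_not_mem_tail hp hpQ (mem_range.1 hi) h).symm hne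
  · intro h; exact absurd (mem_range.2 hk) h

/-- The relabelling `y ↦ (kOf y, rOff (kOf y) y)` of the division step is injective on `[0, Q)`
(indeed `y ≡ ⌊Q·kOf y/p⌉ + rOff (kOf y) y (mod Q)`). [cite: Hales2002, Ch. 5 §1 Algorithm 3 (division by M/N)] -/
theorem rOff_kOf_injective {p Q : ℕ} (hp : 0 < p) (hpQ : p ≤ Q) {y y' : ℕ} (hy : y < Q) (hy' : y' < Q)
    (hk : kOf p Q y = kOf p Q y') (hr : rOff p Q (kOf p Q y) y = rOff p Q (kOf p Q y') y') : y = y' := by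
  have hQ : 0 < Q := lt_of_lt_of_le hp hpQ
  rw [hk] at hr
  unfold rOff at hr
  set n := near p Q (kOf p Q y') with hn
  have hnQ : n ≤ Q := near_le (kOf_lt hp Q y') hpQ
  -- `y + Q − n ≡ y' + Q − n (mod Q)` with both in `[Q − n, 2Q − n)`, an interval of length `Q`... compare quotients
  have h1 := Nat.div_add_mod (y + Q - n) Q
  have h2 := Nat.div_add_mod (y' + Q - n) Q
  rw [hr] at h1
  -- the quotients are `0` or `1`; equal remainders force `|y − y'| ∈ {0, Q}`, and `|y − y'| < Q`
  have hq1 : (y + Q - n) / Q ≤ 1 := by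
    apply Nat.lt_succ_iff.1
    apply Nat.div_lt_of_lt_mul; omega
  have hq2 : (y' + Q - n) / Q ≤ 1 := by
    apply Nat.lt_succ_iff.1
    apply Nat.div_lt_of_lt_mul; omega
  have hm : (y' + Q - n) % Q < Q := Nat.mod_lt _ hQ
  rcases Nat.le_one_iff_eq_zero_or_eq_one.1 hq1 with ha | ha <;>
    rcases Nat.le_one_iff_eq_zero_or_eq_one.1 hq2 with hb | hb <;>
    rw [ha] at h1 <;> rw [hb] at h2 <;> omega

/-! ### The transformed repetition is a unit vector -/

/-- `Σ_{y<Q} |repFT x y|² = 1`: the transform over `ℤ_Q` of the normalised `R`-fold repetition of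
`|x⟩` is a unit vector (Parseval over `ℤ_Q`; the repetition occupies `R` of the indices `< Rp ≤ Q`).
[cite: Hales2002, Ch. 5 §1 Algorithm 3] -/
theorem sum_norm_sq_repFT {p R Q x : ℕ} (hp : 0 < p) (hR : 0 < R) (hRQ : R * p ≤ Q) (hx : x < p) :
    ∑ y ∈ range Q, ‖repFT p R Q x y‖ ^ 2 = 1 := by
  have hQ : 0 < Q := lt_of_lt_of_le (Nat.mul_pos hR hp) hRQ
  have hRQr : (0 : ℝ) < (R : ℝ) * Q := by exact_mod_cast Nat.mul_pos hR hQ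
  set c : ℝ := (Real.sqrt ((R : ℝ) * Q))⁻¹ with hc
  have hc2 : c ^ 2 = ((R : ℝ) * Q)⁻¹ := by rw [hc, inv_pow, Real.sq_sqrt hRQr.le]
  -- `repFT` as a character sum over `k < Rp` with coefficients `c · [p ∣ x − k]`
  set a : ℕ → ℂ := fun k => if (p : ℤ) ∣ (x : ℤ) - k then (c : ℂ) else 0 with ha
  have hrep : ∀ y, repFT p R Q x y = ∑ k ∈ range (R * p), a k * e ((k : ℝ) * y / Q) := by
    intro y
    have h1 : ∀ k ∈ range (R * p), a k * e ((k : ℝ) * y / Q) =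
        if (p : ℤ) ∣ (x : ℤ) - k then (c : ℂ) * e ((k : ℝ) * y / Q) else 0 := by
      intro k _; simp only [ha]; split_ifs <;> simp
    rw [sum_congr rfl h1, sum_range_mul_ite_dvd hx (fun k => (c : ℂ) * e ((k : ℝ) * y / Q)) R, repFT,
      Finset.mul_sum]
  simp_rw [hrep]
  rw [parseval_range hQ hRQ a]
  have h2 : ∀ k ∈ range (R * p), ‖a k‖ ^ 2 = if (p : ℤ) ∣ (x : ℤ) - k then ((c ^ 2 : ℝ) : ℂ).re else 0 := by
    intro k _
    simp only [ha]
    split_ifs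
    · rw [Complex.norm_real, Real.norm_eq_abs, sq_abs]; norm_cast
    · simp
  have h3 : ∑ k ∈ range (R * p), ‖a k‖ ^ 2 = R * c ^ 2 := by
    have := sum_range_mul_ite_dvd hx (fun _ => (((c ^ 2 : ℝ) : ℂ))) R
    have hre := congrArg Complex.re this
    rw [Complex.re_sum, Complex.re_sum] at hre
    rw [sum_congr rfl h2]
    convert hre using 1
    · refine sum_congr rfl fun k _ => ?_; split_ifs <;> simp
    · rw [sum_const, card_range, nsmul_eq_mul, Complex.ofReal_re]
  rw [h3, hc2]
  field_simp

end Hales2002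

end Literature.Computability.Cryptography

end
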